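import Summits.ABC.IUTFork.LanaEtaLimSplitting
import Summits.ABC.IUTFork.LanaEtaLimChecks
import Summits.ABC.IUTFork.LanaEtaLimDictionaryGenuine
import HarnessLib

/-!
# L-LANA vacuity audit: the WHOLE of [IUTchII] Prop. 3.1's `Prop31Statements` HOLDS for LANA's Fig. 3 étale side at
# layer L6's genuine `Π^tp_X̲̲` (degenerate `θ`: the constant `p`) — the hypotheses of `prop31Statements_of_functionData`
# are jointly satisfiable, and satisfied there with "`c` bijective" only

Record-only support file (D-0012; seat abc-iut-c312-4 gen 7, L-LANA level, plan/LLANA-SPEC N14; the cell's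
vacuity audit of fork-level hypothesis structures, LANA Rem. 8.2.1). TAKES NO SIDE on [IUTchIII] Cor. 3.12. Sequel of
`LanaEtaLimSplitting.lean` (`EtaLimSide.prop31Statements_of_functionData`: conjugation clauses + "splittings up to
torsion" [cite: Mochizuki2012, Prop 3.1 (i) p.87] for the record `toThetaEnvData`, from a `FunctionData` presentation of
`θ(Π_v)` with a NON-UNIT value at one label), `LanaEtaLimChecks.lean` (`genuineConstants`: gen 5's `ofDoubleUnderline` at
the genuine data with `θ :=` Kummer classes of `Π^tp_Ÿ̲̲`-fixed integral constants, mono-theta side self-presented) and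
`LanaEtaLimDictionaryGenuine.lean` (isometry of the Galois action, `O^× = (O^▷)^×`). LANA §6.2 (d) p. 34 (`M^Θ_{v,∞}`),
Rem. 6.2.3 p. 36 (the theta values `q_v^{t²}`). [cite: LANA2026Report, §6.2 (d) p. 34, Rem 8.2.1 p. 42]

PROVED (two `abbrev`s: `padicValUnits` = `|·|_p` on `ℚ̄_pˣ` as a monoid homomorphism, `pUnitPadic` = the constant `p`):
`thetaClassOf_ofRootableBy_eq_h1LimKummer` (generic: gen 7's level-`⊤` class of a constant IS abc-iut-w4-d007's `κ_H`),
`kappaH_ofPadic_conj` — the `Π^tp_Ÿ̲̲`-level Kummer class of a `ℚ_p`-rational unit is FIXED by the conjugation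
action of `Π^tp_X̲̲` (`κ(g•a) = g·κ(a)`, abc-iut-w4-d007 `h1LimKummer_smul`, and `g•a = a`); **`genuineConstants_prop31Statements`**
— for every bijective synchronization `c`, abc-iut-L6-t2's `Prop31Statements` ([IUTchII] Prop. 3.1 (i)–(ii) statement-level
content: conjugation action on `{Ψ^ι_env}`, splittings up to torsion, `Ψ_cns` conjugation-stable) HOLDS for the record
`genuineConstants` with the single constant `p` (`|p|_p = 1/p < 1`: a NON-UNIT value, the rôle of `q_v^{t²}`), read as
`ThetaEnvData` — every input of `prop31Statements_of_functionData` discharged at the genuine group (κ injective: w4-d007;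
`O^×`, `O^▷` stable and `O^× = (O^▷)^×`: gen 7; torsion ⊆ `O^×`: gen 7 `mem_unitGrp_of_isOfFinOrder`; valuation
`w := |·|_p` on `ℚ̄_pˣ`). HONEST LABEL: DEGENERATE `θ` (a constant function); genuine group / cohomology / Kummer maps /
integral structure — a certificate that the typed inputs are jointly inhabited, not a model of [EtTh]'s theta function.
NOT here: any judgement.
-/

noncomputable section

namespace Summit.ABC
namespace IUTFork

open Literature.AnabelianGeometry.EtaleTheta
open Literature.IUT.HodgeArakelov
open Literature.IUT.HodgeArakelov.CohomologySystemOfContH1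
open Literature.IUT.HodgeArakelov.EtaleThetaDataOfSetting
open Literature.IUT.HodgeArakelov.TemperedThetaMonoids
open scoped NNReal

variable {p : ℕ} [Fact p.Prime] {D : ThetaSetting p} {E : D.EtaleThetaData} {l : ℕ} (C : E.DoubleUnderline l)
  (hC : D.Compat) [TopologicalSpace (PadicAlgCl p)ˣ]
  (c : CyclotomeCoefficients (phi C) (D.lDeltaTheta l) (PadicAlgCl p)ˣ)

/-- `|·|_p` on `ℚ̄_pˣ` as a monoid homomorphism to `ℝ≥0` (the monotone "valuation" `w` of
`isSplittingUpToTorsion_of_functionData`). [cite: LANA2026Report, §0.4 (b) p. 8] -/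
abbrev padicValUnits : (PadicAlgCl p)ˣ →* ℝ≥0 :=
  (padicVal p).toMonoidWithZeroHom.toMonoidHom.comp (Units.coeHom (PadicAlgCl p))

/-- The constant `p` as a unit of `ℚ̄_p` (`ℚ_p`-rational). [cite: LANA2026Report, §0.4 (b) p. 8] -/
abbrev pUnitPadic : (PadicAlgCl p)ˣ :=
  unitsOfPadic (Units.mk0 (p : ℚ_[p]) (Nat.cast_ne_zero.mpr (Fact.out : p.Prime).ne_zero))

omit [TopologicalSpace (PadicAlgCl p)ˣ] in
/-- `|u|_p = 1` on `O^× = {|·|_p = 1}`. [cite: LANA2026Report, §0.4 (b) p. 8] -/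
theorem padicValUnits_eq_one_of_mem_unitGrp (u : (PadicAlgCl p)ˣ) (hu : u ∈ unitGrp (padicVal p)) :
    padicValUnits u = 1 :=
  (mem_unitGrp_iff (padicVal p) u).mp hu

omit [TopologicalSpace (PadicAlgCl p)ˣ] in
/-- `|p|_p < 1`: the constant `p` is a NON-UNIT of `O^▷` (the rôle of the theta value `q_v^{t²}`, `t ≠ 0`).
[cite: LANA2026Report, Rem 6.2.3 p. 36] -/
theorem padicValUnits_pUnitPadic_lt_one : padicValUnits (pUnitPadic (p := p)) < 1 := by
  change padicVal p (algebraMap ℚ_[p] (PadicAlgCl p) (p : ℚ_[p])) < 1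
  rw [map_natCast, padicVal, PadicAlgCl.valuation_p, one_div]
  exact inv_lt_one_of_one_lt₀ (by exact_mod_cast (Fact.out : p.Prime).one_lt)

section Generic

variable {P : TopGroup.{0}} {G' : Type} [Group G'] [TopologicalSpace G'] [IsTopologicalGroup G']
  (φ : P →* G') (A' : Subgroup G') [A'.Normal] [IsMulCommutative A'] (H : Subgroup P)
  {A : Type} [CommGroup A] [MulDistribMulAction P A] [TopologicalSpace A] [RootableBy A ℕ]
  (c₀ : CyclotomeCoefficients φ A' A) (hA : ∀ b : A, IsOpen (MulAction.stabilizer P b : Set P))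
  (hfi : ∀ b : A, (MulAction.stabilizer P b).FiniteIndex)

/-- The level-`⊤` class `θ_a` of an `H`-fixed CONSTANT `a` (gen 7 `thetaClassOf` with the canonical root system) IS
abc-iut-w4-d007's Kummer class `κ_H(a)` (computable at any level fixing `a`). [cite: LANA2026Report, §6.2 (c) p. 34] -/
theorem thetaClassOf_ofRootableBy_eq_h1LimKummer {a : A} (ha : a ∈ MulAction.fixedPoints H A) :
    thetaClassOf φ A' H c₀ (RootSystem.ofRootableBy a) ha (fun _ => hA _) = h1LimKummer φ A' H c₀ hA hfi a := by
  rw [thetaClassOf, h1LimKummer_apply, h1LimKummerFun_eq_h1Of φ A' H c₀ hA hfi a (Idx.top ⊥)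
    (mem_fixedPoints_inf_of_mem_fixedPoints H _ ha), kummerGmod_eq]

end Generic

/-- **The Kummer class of a `ℚ_p`-rational unit is fixed by the conjugation action of `Π^tp_X̲̲`** on
`∞H¹(Π^tp_Ÿ̲̲, l·Δ_Θ)`: `g·κ_H(a) = κ_H(g•a) = κ_H(a)` (abc-iut-w4-d007 `h1LimKummer_smul`; `ℚ_p` is fixed by `G_{ℚ_p}`).
[cite: Mochizuki2012, Prop 3.1 (ii) p.88] -/
theorem kappaH_ofPadic_conj [(PiYdd C).Normal] (g : Pi C) (x : ℚ_[p]ˣ) :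
    h1LimConjMulAut (phi C) (D.lDeltaTheta l) (PiYdd C) g
        (h1LimKummer (phi C) (D.lDeltaTheta l) (PiYdd C) c (isOpen_stabilizer_units C)
          (finiteIndex_stabilizer_units C) (unitsOfPadic x)) =
      h1LimKummer (phi C) (D.lDeltaTheta l) (PiYdd C) c (isOpen_stabilizer_units C)
        (finiteIndex_stabilizer_units C) (unitsOfPadic x) := by
  rw [← h1LimKummer_smul]
  congr 1
  exact unitsOfPadic_mem_fixedPoints C ⊤ x ⟨g, Subgroup.mem_top g⟩

omit [TopologicalSpace (PadicAlgCl p)ˣ] in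
/-- `p ∈ ℚ̄_pˣ` is fixed by `Π^tp_Ÿ̲̲`. [cite: LANA2026Report, §3.9 p. 21] -/
theorem pUnitPadic_mem_fixedPoints (_t : PUnit) :
    pUnitPadic (p := p) ∈ MulAction.fixedPoints (PiYdd C) (PadicAlgCl p)ˣ :=
  unitsOfPadic_mem_fixedPoints C (PiYdd C) _

/-- **`Prop31Statements` ([IUTchII] Prop. 3.1 (i)–(ii) as typed by abc-iut-L6-t2) HOLDS for LANA's Fig. 3 étale side at
the genuine `Π^tp_X̲̲`** — record `genuineConstants` (gen 7 `LanaEtaLimChecks`: `θ := {κ_H(p)}`, `O^▷ = {|·|_p ≤ 1}`,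
mono-theta side self-presented) read as `ThetaEnvData`, for EVERY bijective synchronization `c`: conjugation action on
`Ψ_env`, splitting up to torsion of `M^Θ_{v,∞} = O^×(Π_v)·⟨∞θ(Π_v)⟩`, `Ψ_cns` conjugation-stable — ALL PROVED (degenerate
`θ`; every other input genuine). [cite: Mochizuki2012, Prop 3.1 p.87] [cite: LANA2026Report, §6.2 (d) p. 34, Rem 8.2.1 p. 42] -/
theorem genuineConstants_prop31Statements (hc : Function.Bijective c.hom) :
    haveI := piYdd_normal C hC
    Prop31Statements
      ((genuineConstants C (padicVal p) c (fun _ : PUnit => pUnitPadic) (pUnitPadic_mem_fixedPoints C)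
          ⟨pUnitPadic, unitsOfPadic_p_mem_intMonoidUnits⟩).toThetaEnvData
        (h1LimKummer_injective_of_coeff C (phi C) (D.lDeltaTheta l) c (PiYdd C) hc) (genuine_hunits (p := p))) := by
  haveI := piYdd_normal C hC
  refine EtaLimSide.prop31Statements_of_functionData _ _ _ (smul_mem_unitGrp_padicVal C)
    (smul_mem_intMonoidUnits_padicVal C) (fun g => ?_)
    (EtaLimSide.FunctionData.ofConstants _ (fun _ : PUnit => pUnitPadic) (pUnitPadic_mem_fixedPoints C)
      (fun _ => unitsOfPadic_p_mem_intMonoidUnits) fun _ hx => hx)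
    PUnit.unit (h1LimKummer_injective_of_coeff C (phi C) (D.lDeltaTheta l) c (PiYdd C) hc) hc
    (padicValUnits (p := p)) (padicValUnits_eq_one_of_mem_unitGrp (p := p))
    (fun ζ hζ => mem_unitGrp_of_isOfFinOrder (padicVal p) hζ) fun _ => padicValUnits_pUnitPadic_lt_one (p := p)
  -- `θ = {κ_H(p)}` is conjugation-stable: `κ_H(p)` is FIXED
  have hfix : ∀ i : PUnit, h1LimConjMulAut (phi C) (D.lDeltaTheta l) (PiYdd C) g
      (thetaClassOf (phi C) (D.lDeltaTheta l) (PiYdd C) c (RootSystem.ofRootableBy pUnitPadic)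
        (pUnitPadic_mem_fixedPoints C i) fun _ => isOpen_stabilizer_units C _) =
      thetaClassOf (phi C) (D.lDeltaTheta l) (PiYdd C) c (RootSystem.ofRootableBy pUnitPadic)
        (pUnitPadic_mem_fixedPoints C i) fun _ => isOpen_stabilizer_units C _ := fun i => by
    rw [thetaClassOf_ofRootableBy_eq_h1LimKummer (phi C) (D.lDeltaTheta l) (PiYdd C) c (isOpen_stabilizer_units C)
      (finiteIndex_stabilizer_units C)]
    exact kappaH_ofPadic_conj C c g _
  show (h1LimConjMulAut (phi C) (D.lDeltaTheta l) (PiYdd C) g) ''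
      thetaOfConstants C c (fun _ : PUnit => pUnitPadic) (pUnitPadic_mem_fixedPoints C) =
    thetaOfConstants C c (fun _ : PUnit => pUnitPadic) (pUnitPadic_mem_fixedPoints C)
  rw [thetaOfConstants]
  ext y
  constructor
  · rintro ⟨_, ⟨i, rfl⟩, rfl⟩
    exact ⟨i, (hfix i).symm⟩
  · rintro ⟨i, rfl⟩
    exact ⟨_, ⟨i, rfl⟩, hfix i⟩

end IUTFork

end Summit.ABC

end
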